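import Summits.QuantumFields.BalabanUV.Beta.D1BFx.AssemblySlotsBal
import Summits.QuantumFields.BalabanUV.Beta.D1BFx.SplitInstance

/-!
# Road BF-x, A7 END: the road's target `T` at a block size `n` from (K), (REST), (U) — every other slot DISCHARGED

Owner file of road «BF-x» (BINDER-OWNERS row D1, co-owner d1-p2).  `D1BFx/Assembly.abs_defect_le_of_slots` (p219112) derives the road's
target from six typed slots (K)(F)(CONV)(SPLIT)(U)(REST).  This file PLUGS the landed instances into it at a fixed block size `n ≥ 2`, `Odd n`
(centred ghost root), for the two fine-loop pieces of record — the R-weighted gluon piece `TOfRed n a SbfBal (tableRed n Wbf)` and the completed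
ghost piece `PghQ n a x₀ cK cQ` — with MAIN term an3's `stK μ ν N (gp b)` over the frozen profile and REST words `SplitInstance.restK`:

* (F)/(CONV) gluon: `AssemblySlotsBal.hF_SbfBal` / `conv_SbfBal` (block-covariant K-R5 junction);
* (F)/(CONV) ghost: `AssemblySlots.hF_PghQ_of_wardRows` / `conv_PghQ`;
* (SPLIT): `SplitInstance.split_at_basePoint` (A0-FINE ∘ A1.ii, p220987).

`defect_le_at`: what REMAINS displayed, by name — (K) the one-shot coefficient `c` as `ω_gl·secondMoment(gluon piece) + ω_gh·secondMoment(ghost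
piece) + Σ_u Ru u` with the loop-weight ratio `ω_gh·cK² = −2·ω_gl·cE²` and normalisation `ω_gl·cE² = 2N²·lam`; the leg binder `Spr (Ga n a)`; the
five slot tables bi-localised at a common rate / block-covariant / bond-swap symmetric; K-R5's analytic inputs `hrow`, `hT1` (gluon) and the
ghost Ward rows `hrowgh`; the frozen profile's exponential bound and evenness; (CONV) and the bounds (REST) for the `RestIdx` words (the corner
word is settled by `CornerRest.rest_corner_bound` under `n⁻⁸·lam = 1`); (U) bounds for the unit pieces.  `hT_of_pointwise`: the scale glue
`n = Lc^m`, `Odd Lc`, giving literally the `hT` binder shape of `RoadEnd.d1Drift_of_strongRoad`.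

HONEST STATUS: assembly [folklore]; no cited facts; D1 NOT discharged — (K), (REST) (all words but the corner), (U) and the analytic K-R5
inputs are OPEN hypotheses here.  HONEST DEPENDENCY: continuum YM on T⁴ ⇐ BetaPertH ∧ nine spine estimates (0/9 proved); BetaPertH ⇐ (D1) ∧
(D4) ∧ CAP+tail; G-an2-4 gates asym, D1 and NE2/3/4.
-/

open Finset Filter Topology
open scoped BigOperators
open Literature.MathematicalPhysics.QuantumFieldTheory.Balaban1983to89
open Literature.MathematicalPhysics.QuantumFieldTheory.Balaban1983to89.Beta
open WindowIdentification (fullSum psum)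
open B12Sec2to5 (l1)
open DyadicShell (Pt toReal)
open ExpKernelCalculus (Site MKer BiLoc shiftK)
open SquareTable (stK)
open DressedMomentNormalisation (resSite)
open Summit.QuantumFields.BalabanUV.Beta.TameKernelCalculus (Spr Loc)
open Summit.QuantumFields.BalabanUV.Beta.D1BFx.MomentTransferPeriodic (baseKer)
open Summit.QuantumFields.BalabanUV.Beta.D1BFx.GluonLeg (Ga)
open Summit.QuantumFields.BalabanUV.Beta.D1BFx.ReducedKernel (TableR TOfRed)
open Summit.QuantumFields.BalabanUV.Beta.D1BFx.DressedTadpoleTable (tableRed)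
open Summit.QuantumFields.BalabanUV.Beta.D1BFx.ReducedKernelSandwich (fineHess)
open Summit.QuantumFields.BalabanUV.Beta.D1BFx.FineStencilBFBalaban (SbfBal)
open Summit.QuantumFields.BalabanUV.Beta.D1BFx.SecondStencilBF (Wbf)
open Summit.QuantumFields.BalabanUV.Beta.D1BFx.GhostKernelComplete (PghQ fineHessGhQ)
open Summit.QuantumFields.BalabanUV.Beta.D1BFx.SplitInstance (RestIdx restK split_at_basePoint)
open Summit.QuantumFields.BalabanUV.Beta.D1BFx.Assembly (abs_defect_le_of_slots)
open Summit.QuantumFields.BalabanUV.Beta.D1BFx.AssemblySlots (conv_PghQ hF_PghQ_of_wardRows)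
open Summit.QuantumFields.BalabanUV.Beta.D1BFx.AssemblySlotsBal (hF_SbfBal conv_SbfBal)

namespace Summit.QuantumFields.BalabanUV.Beta.D1BFx.AssemblyEnd

/-! ## §1 The road's defect bound at one block size -/

section At

variable (n : ℕ) [NeZero n] (a cE cVH cΛ cR cK cQ cE₂ cJ4 cΛ₂ cR₂ cQ₂ x₀ ωgl ωgh lam N : ℝ) {WE WJ WΛ WR WQ : TableR}
  {CE CJ CΛ CRt CQ δW : ℝ} {gp : Pt → Pt → ℝ} {μ ν : Fin 4} {υ : Type*} [Fintype υ] {c : ℝ} {Ru CU : υ → ℝ} {CR : RestIdx → ℝ}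

/-- [folklore] **ROAD BF-x AT BLOCK SIZE `n` (`2 ≤ n`, `Odd n`): `|c − Σ_{b ∈ image resSite} n⁻⁴·fullSum (stK μ ν N (gp b))| ≤ Σ_u CU u + Σ_τ CR τ`**
from (K) the kernel representation of `c` through the two fine-loop pieces of record with the loop-weight ratio and normalisation, the leg binder,
the slot-table sockets, K-R5's `hrow`/`hT1`, the ghost Ward rows, the frozen profile's bound and evenness, (CONV)+(REST) for the `RestIdx` words and
(U) — slots (F), (CONV) of both pieces and (SPLIT) being DISCHARGED by the landed instances. -/
theorem defect_le_at (hn : 2 ≤ n) (hodd : Odd n) (ha : 0 < a) (hμν : μ ≠ ν) (hGa : Spr (Ga n a))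
    (hK : c = ωgl * B12Beta.secondMoment (TOfRed n a (SbfBal n a cE cVH cΛ cR cK cQ)
        (tableRed n (Wbf cE₂ cJ4 cΛ₂ cR₂ cQ₂ WE WJ WΛ WR WQ))) μ ν
      + ωgh * B12Beta.secondMoment (PghQ n a x₀ cK cQ) μ ν + ∑ u, Ru u)
    (hω : ωgh * cK ^ 2 = -2 * (ωgl * cE ^ 2)) (hlam : ωgl * cE ^ 2 = 2 * N ^ 2 * lam)
    (hδW : 0 < δW)
    (hE : ∀ κ u l u', BiLoc (WE κ u l u') u u' CE δW) (hJ : ∀ κ u l u', BiLoc (WJ κ u l u') u u' CJ δW)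
    (hΛ : ∀ κ u l u', BiLoc (WΛ κ u l u') u u' CΛ δW) (hR : ∀ κ u l u', BiLoc (WR κ u l u') u u' CRt δW)
    (hQ : ∀ κ u l u', BiLoc (WQ κ u l u') u u' CQ δW)
    (hEc : ∀ (κ : Fin 4) (u : Site 4) (l : Fin 4) (u' t : Site 4), WE κ (u + (n : ℤ) • t) l (u' + (n : ℤ) • t) = shiftK (-((n : ℤ) • t)) (WE κ u l u'))
    (hJc : ∀ (κ : Fin 4) (u : Site 4) (l : Fin 4) (u' t : Site 4), WJ κ (u + (n : ℤ) • t) l (u' + (n : ℤ) • t) = shiftK (-((n : ℤ) • t)) (WJ κ u l u'))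
    (hΛc : ∀ (κ : Fin 4) (u : Site 4) (l : Fin 4) (u' t : Site 4), WΛ κ (u + (n : ℤ) • t) l (u' + (n : ℤ) • t) = shiftK (-((n : ℤ) • t)) (WΛ κ u l u'))
    (hRc : ∀ (κ : Fin 4) (u : Site 4) (l : Fin 4) (u' t : Site 4), WR κ (u + (n : ℤ) • t) l (u' + (n : ℤ) • t) = shiftK (-((n : ℤ) • t)) (WR κ u l u'))
    (hQc : ∀ (κ : Fin 4) (u : Site 4) (l : Fin 4) (u' t : Site 4), WQ κ (u + (n : ℤ) • t) l (u' + (n : ℤ) • t) = shiftK (-((n : ℤ) • t)) (WQ κ u l u'))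
    (hEs : ∀ κ u l u', WE κ u l u' = WE l u' κ u) (hJs : ∀ κ u l u', WJ κ u l u' = WJ l u' κ u) (hΛs : ∀ κ u l u', WΛ κ u l u' = WΛ l u' κ u)
    (hRs : ∀ κ u l u', WR κ u l u' = WR l u' κ u) (hQs : ∀ κ u l u', WQ κ u l u' = WQ l u' κ u)
    (hrow : ∀ (κ' l' : Fin 4) (b : Site 4),
      HasSum (fineHess n a (SbfBal n a cE cVH cΛ cR cK cQ) (Wbf cE₂ cJ4 cΛ₂ cR₂ cQ₂ WE WJ WΛ WR WQ) κ' l' b) 0)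
    (hT1 : ∀ (κ' l' μ' : Fin 4), ∑ r : Fin 4 → Fin n, ∑' t, (t μ' : ℝ) *
      baseKer (fineHess n a (SbfBal n a cE cVH cΛ cR cK cQ) (Wbf cE₂ cJ4 cΛ₂ cR₂ cQ₂ WE WJ WΛ WR WQ) κ' l') (resSite r) t = 0)
    (hrowgh : ∀ (κ' l' : Fin 4) (b : Site 4), HasSum (fineHessGhQ n a x₀ cK cQ κ' l' b) 0)
    (hg : ∀ b : Pt, ∃ C δ : ℝ, 0 < δ ∧ ∀ v, |gp b v| ≤ C * Real.exp (-δ * l1 v)) (hgev : ∀ b w : Pt, gp b (-w) = gp b w)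
    (hKr : ∀ τ : RestIdx, ∀ b ∈ (univ : Finset (Fin 4 → Fin n)).image resSite, ∃ B, Tendsto (psum (fun w : Pt =>
      restK n a (gp b) cE cΛ cR cK cQ cE₂ cJ4 cΛ₂ cR₂ cQ₂ x₀ WE WJ WΛ WR WQ ωgl ωgh lam N μ ν b τ w)) atTop (𝓝 B))
    (hRest : ∀ τ : RestIdx, |∑ b ∈ (univ : Finset (Fin 4 → Fin n)).image resSite, ((n : ℝ) ^ 4)⁻¹ * fullSum (fun w : Pt =>
      restK n a (gp b) cE cΛ cR cK cQ cE₂ cJ4 cΛ₂ cR₂ cQ₂ x₀ WE WJ WΛ WR WQ ωgl ωgh lam N μ ν b τ w)| ≤ CR τ)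
    (hU : ∀ u, |Ru u| ≤ CU u) :
    |c - ∑ b ∈ (univ : Finset (Fin 4 → Fin n)).image resSite, ((n : ℝ) ^ 4)⁻¹ * fullSum (stK μ ν N (gp b))|
      ≤ (∑ u, CU u) + ∑ τ, CR τ := by
  have h1 : 1 ≤ n := le_trans one_le_two hn
  have hEl : ∀ κ u l u', Loc (WE κ u l u') := fun κ u l u' => ⟨u, u', CE, δW, hδW, hE κ u l u'⟩
  have hJl : ∀ κ u l u', Loc (WJ κ u l u') := fun κ u l u' => ⟨u, u', CJ, δW, hδW, hJ κ u l u'⟩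
  have hΛl : ∀ κ u l u', Loc (WΛ κ u l u') := fun κ u l u' => ⟨u, u', CΛ, δW, hδW, hΛ κ u l u'⟩
  have hRl : ∀ κ u l u', Loc (WR κ u l u') := fun κ u l u' => ⟨u, u', CRt, δW, hδW, hR κ u l u'⟩
  have hQl : ∀ κ u l u', Loc (WQ κ u l u') := fun κ u l u' => ⟨u, u', CQ, δW, hδW, hQ κ u l u'⟩
  refine abs_defect_le_of_slots (ι := Fin 2) (T := RestIdx) (υ := υ) (μ := μ) (ν := ν) (N := N) (CU := CU) (CR := CR)
    (c := fun _ => c) (Bset := fun _ => (univ : Finset (Fin 4 → Fin n)).image resSite) (wt := fun _ _ => ((n : ℝ) ^ 4)⁻¹)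
    (Gf := fun _ => gp)
    (P := fun i _ => if i = 0 then TOfRed n a (SbfBal n a cE cVH cΛ cR cK cQ) (tableRed n (Wbf cE₂ cJ4 cΛ₂ cR₂ cQ₂ WE WJ WΛ WR WQ))
      else PghQ n a x₀ cK cQ)
    (ω := fun i _ => if i = 0 then ωgl else ωgh) (R := fun u _ => Ru u)
    (Kf := fun i _ b w => if i = 0 then ((n : ℝ) ^ 8)⁻¹ * (toReal w μ * toReal w ν *
        baseKer (fineHess n a (SbfBal n a cE cVH cΛ cR cK cQ) (Wbf cE₂ cJ4 cΛ₂ cR₂ cQ₂ WE WJ WΛ WR WQ) μ ν) b w)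
      else ((n : ℝ) ^ 8)⁻¹ * (toReal w μ * toReal w ν * baseKer (fineHessGhQ n a x₀ cK cQ μ ν) b w))
    (Kr := fun τ _ b w => restK n a (gp b) cE cΛ cR cK cQ cE₂ cJ4 cΛ₂ cR₂ cQ₂ x₀ WE WJ WΛ WR WQ ωgl ωgh lam N μ ν b τ w)
    ?_ ?_ ?_ ?_ ?_ ?_ ?_ n hn
  · -- (K)
    intro _ _
    rw [Fin.sum_univ_two]
    simp only [Fin.isValue, if_true, one_ne_zero, if_false]
    exact hK
  · -- (F)
    intro i _ _
    fin_cases i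
    · simp only [Fin.zero_eta, Fin.isValue, if_true]
      exact hF_SbfBal n a cE cVH cΛ cR cK cQ cE₂ cJ4 cΛ₂ cR₂ cQ₂ h1 ha hGa hδW hE hJ hΛ hR hQ hEc hJc hΛc hRc hQc hEs hJs hΛs hRs hQs
        hrow hT1 μ ν
    · simp only [Fin.mk_one, Fin.isValue, one_ne_zero, if_false]
      exact hF_PghQ_of_wardRows n a x₀ cK cQ ha hodd hrowgh μ ν
  · -- (CONV) fine pieces
    intro i _ _
    fin_cases i
    · simp only [Fin.zero_eta, Fin.isValue, if_true]
      exact conv_SbfBal n a cE cVH cΛ cR cK cQ cE₂ cJ4 cΛ₂ cR₂ cQ₂ ha hGa hδW hE hJ hΛ hR hQ μ ν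
    · simp only [Fin.mk_one, Fin.isValue, one_ne_zero, if_false]
      exact conv_PghQ n a x₀ cK cQ ha μ ν
  · -- (CONV) rest words
    intro τ _ _ b hb
    exact hKr τ b hb
  · -- (SPLIT)
    intro _ _ b _ w
    rw [Fin.sum_univ_two]
    simp only [Fin.isValue, if_true, one_ne_zero, if_false]
    obtain ⟨C, δ, hδ, hgb⟩ := hg b
    exact split_at_basePoint n a cE cVH cΛ cR cK cQ cE₂ cJ4 cΛ₂ cR₂ cQ₂ x₀ WE WJ WΛ WR WQ ha hGa hδ hgb (hgev b) hEl hJl hΛl hRl hQl hμν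
      hω hlam b w
  · -- (U)
    intro u _ _
    exact hU u
  · -- (REST)
    intro τ _ _
    exact hRest τ

end At

/-! ## §2 The scale glue `n = Lc^m` -/

/-- [folklore] **FROM A POINTWISE BOUND AT EVERY ODD `n ≥ 2` TO THE `hT` BINDER SHAPE** of `RoadEnd.d1Drift_of_strongRoad` along `n = Lc^m`, `m ≥ 1`,
for an odd blocking factor `Lc ≥ 2` (odd: every block has a centre — the centred ghost root). -/
theorem hT_of_pointwise {Lc : ℕ} {c F : ℕ → ℝ} {U : ℝ} (h : ∀ n : ℕ, 2 ≤ n → Odd n → |c n - F n| ≤ U)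
    (hLc : 2 ≤ Lc) (hodd : Odd Lc) : ∀ m : ℕ, 1 ≤ m → |c (Lc ^ m) - F (Lc ^ m)| ≤ U :=
  fun m hm => h _ (le_trans hLc (by simpa using Nat.pow_le_pow_right (le_trans one_le_two hLc) hm)) hodd.pow

end Summit.QuantumFields.BalabanUV.Beta.D1BFx.AssemblyEnd
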